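import Literature.NumberTheory.EllipticCurves.GreenbergVatsal2000.CongruentCurves
import HarnessLib

/-!
# Kraus–Oesterlé, *Sur une question de B. Mazur* (Math. Ann. 293 (1992) 259–275), Proposition 4:
# the finite trace-congruence criterion for `E[p] ≅ E'[p]`

HONEST FRAMING (cell `b2b-bsdres`, home `run/shared/lean/b2b/bsd-rank1-residual/`): the cell deletes
COMBINATION-SHAPED residual classes of the rank-`≤ 1` BSD formula from PUBLISHED theorems only and
types the rest; this is not "finishing BSD". This statement file vendors ONE published theorem as a
named fact (D-0014), in the tree's vocabulary, with two auxiliary arithmetic definitions (the index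
`[SL₂(ℤ) : Γ₀(M)]` and the Kraus–Oesterlé modulus `M`). Its role in the cell: it turns the
certificate C1 of route U1′ for class X9 — "a `Γ_ℚ`-equivariant isomorphism `A[p] ≃ E[p]`", the
hypothesis `hC1` of `Rank1Residual.X9.bsdp_of_cmPartner_of_certificates` (`X9CMPartner.lean`) and of
`GreenbergVatsal2000.mazurMainConjecture_of_cmCongruence` — into a FINITE, EXACT, REPRODUCIBLE
check: finitely many congruences between traces of Frobenius below an explicit Sturm-type bound
(referee ruling R17.3 (3): "C1 = trace comparison to the Kraus–Oesterlé/Sturm bound").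

SOURCE AND ITS STATUS. Primary: A. Kraus, J. Oesterlé, Math. Ann. 293 (1992), no. 2, 259–275,
doi:10.1007/bf01444715, Proposition 4 — at vendoring time NOT HELD by the hub (paywalled;
acquisition request acq-05563), hence flag `KO92-secondary`. PRIMARY READ 2026-08-19 (cell
`b2b-bsdres`, literature seat gen 7) on the open GDZ scan of Math. Ann. vol. 293
(gdz.sub.uni-goettingen.de, PPN235181684_0293, LOG_0024; page images + README in
run/shared/lean/b2b/bsd-rank1-residual/b2b-bsdres-lit/g7/ko92/): p. 262 §3 "Soient `E` et `E'` deux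
courbes elliptiques définies sur `ℚ`. Notons `N` et `N'` leurs conducteurs … Soit `p` un nombre
premier. Notons `ρ` et `ρ'` les représentations … points de `p`-torsion"; p. 263 "Proposition 4.
Supposons que `E` et `E'` soient des courbes de Weil (ce qui conjecturalement est toujours le cas).
Notons `S` l'ensemble des nombres premiers `ℓ` en lesquels l'une des courbes a réduction
multiplicative déployée et l'autre réduction multiplicative non déployée. Posons
`M = ppcm(N, N') ∏_{ℓ∈S} ℓ` et `μ(M) = |ℙ¹(ℤ/Mℤ)| = M ∏_{ℓ∣M} (1 + ℓ⁻¹)`. Les conditions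
suivantes sont équivalentes: (i) les représentations `ρ` et `ρ'` ont des semi-simplifiées
isomorphes;" p. 264 "(ii) pour tout nombre premier `ℓ < μ(M)/6` ne divisant pas `NN'`, on a
`a_ℓ ≡ a'_ℓ mod p`; pour tout nombre premier `ℓ < μ(M)/6` tel que `ℓ ∣ NN'` et `ℓ² ∤ NN'`, on a
`a_ℓ a'_ℓ ≡ ℓ + 1 mod p`." (and p. 265: irreducible ⇒ "donc sont isomorphes"). The transcription
below agrees with the primary word for word ("courbes de Weil" = modularity, BCDT 2001). The two
published restatements through which it was first read, attributing it to [KO]: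
* T. Fisher, *On pairs of 17-congruent elliptic curves*, arXiv:2106.02033, Lemma 2.2 "(KO)"
  [store `paper:arxiv-2106.02033`, chunk p0004 L18–L33]: "Let `E` and `E'` be modular elliptic
  curves over `ℚ` with conductors `N` and `N'`. Let `S` be the set of primes for which one of the
  curves has split multiplicative reduction, and the other has non-split multiplicative reduction.
  Let `M = lcm(N,N') ∏_{ℓ ∈ S} ℓ` and `μ(M) = [SL₂(ℤ) : Γ₀(M)] = #ℙ¹(ℤ/Mℤ) = M ∏_{ℓ ∣ M} (1 + ℓ⁻¹)`.
  Then the following conditions are equivalent. (i) The Galois modules `E[p]` and `E'[p]` have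
  isomorphic semi-simplifications. (ii) `a_ℓ(E) ≡ a_ℓ(E') (mod p)` for all primes `ℓ < μ(M)/6`
  with `v_ℓ(NN') = 0`; and `a_ℓ(E) a_ℓ(E') ≡ ℓ + 1 (mod p)` for all primes `ℓ < μ(M)/6` with
  `v_ℓ(NN') = 1`." (preceded by: "They [Kraus and Oesterlé [KO]] also established the following
  results.")
* J. Cremona, N. Freitas, *Global methods for the symplectic type of congruences between elliptic
  curves*, Rev. Mat. Iberoam. 38 (2022) = arXiv:1910.12290, §3.2 [store `paper:arxiv-1910.12290`,
  chunk p0015 L9–L17]: "we use a criterion of Kraus–Oesterlé (see [KO]), based on the Sturm bound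
  and hence on the modularity of elliptic curves over `ℚ`, to either prove isomorphism up to
  semisimplification, or reveal a "false positive"."
"Modular" is now automatic for every `E/ℚ` (Breuil–Conrad–Diamond–Taylor 2001).

## Contents

* `gammaZeroIndex M` (DEFINITION): `[SL₂(ℤ) : Γ₀(M)] = M ∏_{ℓ ∣ M} (1 + 1/ℓ) = ∏_{ℓ^e ∥ M} ℓ^{e-1}(ℓ+1)`
  (Dedekind's `ψ(M)`), as a natural number through `Nat.factorization`.
* `modulus W W'` (DEFINITION): the Kraus–Oesterlé modulus `M = lcm(N, N') · ∏_{ℓ ∈ S} ℓ`, `S` the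
  set of primes at which one curve is split multiplicative and the other non-split multiplicative
  (such `ℓ` divide `gcd(N, N')`, over whose prime factors the product is filtered).
* `prop4_torsionIso_of_congruences` (NAMED FACT, PUB, flag `KO92-secondary`; scope flag
  `KO92-Prop4-(ii)b-frobeniusTrace-offset`, see the faithfulness paragraph and the scope note): the
  implication (ii) ⇒ (i) of Proposition 4 in the case "`E[p]` irreducible", where (i) upgrades to an
  honest isomorphism `E[p] ≅ E'[p]` — see the faithfulness paragraph. Its print-faithful twin in
  Hasse–Weil currency is `prop4_torsionIso_of_congruences_hasseWeil`
  (`TorsionCongruenceCriterionHasseWeil.lean`, same story).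

## Transcription and faithfulness

`a_ℓ(E)` is transcribed as the tree's `W.frobeniusTrace ℓ = ℓ + 1 - N_ℓ` of a globally minimal
model (`GlobalMinimalModel`), `N_ℓ = reductionPointCount W ℓ = #Ẽ_ns(𝔽_ℓ)` (the nonsingular points
with `O`). At a prime `ℓ` of GOOD reduction this IS the Hasse–Weil coefficient `a_ℓ` of the paper
(`WeierstrassCurve.LFunction_apply_prime_eq_frobeniusTrace`, PROVED, `LFunctionPrimeCoeff.lean`),
so the first conjunct of (ii) («`ℓ ∤ NN'`») is print's in this spelling. CORRECTION (DD-81; an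
earlier version of this paragraph asserted that `frobeniusTrace` «at a prime of bad reduction is the
usual `a_ℓ ∈ {0, 1, -1}` … exactly the coefficient of the `L`-series used in (ii)», which is
FALSE): at a prime of BAD reduction `N_ℓ = #Ẽ_ns(𝔽_ℓ) = ℓ - a_ℓ`, hence
`frobeniusTrace W ℓ = 1 + a_ℓ`, i.e. `2` at a split multiplicative, `0` at a non-split
multiplicative and `1` at an additive prime (docstrings of `reductionPointCount` / `frobeniusTrace`
in `GlobalMinimalModel.lean`; PROVED `reductionPointCount_of_mult`
(`LocalTorsionMultiplicativeProofs.lean`) and `KrausOesterle1992.frobeniusTrace_eq_lFunction_add_one_of_mult`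
(`TorsionCongruenceCriterionHasseWeilProofs.lean`); Silverman, *AEC* Ex. 3.5) — NOT the paper's
Hasse–Weil `a_ℓ = ±1` there (p. 262 §3 «`∑ a_n n^{-s}` et `∑ a'_n n^{-s}` leurs fonctions `L` de
Hasse–Weil»; p. 262 Lemme 1 «réduction multiplicative déployée en `ℓ`, on a `a_ℓ = 1` … non
déployée …, `a_ℓ = -1`»; p. 263 L8–9 «Comme on a `a'_ℓ = ±1`, on a `a_ℓ a'_ℓ ≡ ℓ + 1 mod p`»). In the
second conjunct of (ii) («`ℓ ∣ NN'`, `ℓ² ∤ NN'`»: exactly one of the two curves is multiplicative at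
`ℓ`, the other good) the typed divisibility `p ∣ frobeniusTrace W ℓ * frobeniusTrace W' ℓ - (ℓ + 1)`
therefore reads — writing `a_ℓ` for the good curve's coefficient and `a'_ℓ = ±1` for the
multiplicative curve's — «`p ∣ 2·a_ℓ − (ℓ + 1)`» (the multiplicative curve split) or «`p ∣ ℓ + 1`»
(non-split) instead of print's «`p ∣ a_ℓ a'_ℓ − (ℓ + 1)`». SCOPE NOTE
(`KO92-Prop4-(ii)b-frobeniusTrace-offset`; ARM-P REGISTER R-20, reader sheet
`pub/bsd-cited/sheets/D-AUDIT-r07-Q41-KO92-LS18.md` d816b43f675df775 §V1–§V4 + ADDENDUM-1, with a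
numerical witness 2760k1 ↔ 6440i1, `p = 5`: print's (ii) ✓, the typed (ii) ✗): HYPOTHESIS (ii) AS
TYPED equals print's (ii) exactly on the pairs `(W, W')` having NO prime `ℓ` with `6ℓ < μ(M)` and
`v_ℓ(NN') = 1` («unexposed» pairs — PROVED `congruenceList_hasseWeil_iff_of_noExposedPrime`,
`TorsionCongruenceCriterionHasseWeil.lean`); on a pair with such an «exposed» prime the typed list is
a DIFFERENT test from print's, so there this declaration is NOT a transcription of Proposition 4 and
nothing printed implies it. The print-faithful statement is the twin
`prop4_torsionIso_of_congruences_hasseWeil` (`TorsionCongruenceCriterionHasseWeil.lean`): identical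
except that the `= 1 →` conjunct is spelled over Mathlib's `WeierstrassCurve.LFunction ℓ` (= the
Hasse–Weil `a_ℓ` at EVERY prime); consumers displaying the list on an exposed pair re-key to it by
that one token (forwarder `torsionIso_of_congruences_hasseWeil`), consumers on unexposed pairs bridge
by name (`torsionIso_of_congruences_hasseWeil_of_noExposedPrime`). This declaration's STATEMENT is
deliberately left as typed (D-0026: a mis-transcription is corrected under a NEW name, never edited
in place; its truth value as a closed `Prop` is the separate target ARM-P T-Q41-2). "`v_ℓ(NN') = 0`",
"`= 1`" are `padicValNat ℓ (N·N') = 0`, `= 1` with `N = W.conductorNorm ℤ`; "`ℓ < μ(M)/6`" is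
`6ℓ < μ(M)` in `ℕ`; the congruences are divisibilities in `ℤ`. HYPOTHESIS (ii) is transcribed clause
by clause in print's SHAPE; its second conjunct is print's CONTENT only in Hasse–Weil currency (scope
note above). CONCLUSION: the source gives (i), isomorphic
SEMI-SIMPLIFICATIONS; this file states the case `E[p]` irreducible (`W.HasIrreducibleModPGaloisRep p`,
an extra hypothesis), in which (i) is equivalent to `E[p] ≅ E'[p]` as `𝔽_p[Γ_ℚ]`-modules: an
irreducible `E[p]` is its own semi-simplification, and a two-dimensional `E'[p]` whose
semi-simplification is irreducible is itself irreducible (a `Γ_ℚ`-stable line would make the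
semi-simplification a sum of two characters), hence equal to its semi-simplification. The
isomorphism is spelled, as everywhere in the cell (`GreenbergVatsal2000.thm14_…`,
`Mazur1978.hasIrreducibleModPGaloisRep_of_addEquiv`), as a `Γ_ℚ`-equivariant additive (hence
`𝔽_p`-linear) equivalence `geomTorsion W p ≃+ geomTorsion W' p`. So the Lean statement is the
special case "(ii) ∧ `E[p]` irreducible ⇒ `E[p] ≅ E'[p]`" of the printed equivalence — never
stronger than print. `-- TODO(general form): (i) ⇔ (ii) with semi-simplifications, once the tree
has a semi-simplification functor for `𝔽_p[Γ_ℚ]`-modules.`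

## References
* A. Kraus, J. Oesterlé, Math. Ann. 293 (1992) 259–275, Prop. 4. [KrausOesterle1992]
* T. Fisher, arXiv:2106.02033 (2021), Lemma 2.2. [Fisher2021SeventeenCongruent]
* J. E. Cremona, N. Freitas, Rev. Mat. Iberoam. 38 (2022), §3.2. [CremonaFreitas2022]
* J. Sturm, *On the congruence of modular forms*, LNM 1240 (1987) 275–280 (the bound).
-/

set_option autoImplicit false

noncomputable section

open scoped Classical

open WeierstrassCurve Literature.NumberTheory.EllipticCurves

namespace Literature.NumberTheory.EllipticCurves.KrausOesterle1992

/-! ### The index `[SL₂(ℤ) : Γ₀(M)]` and the Kraus–Oesterlé modulus -/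

/-- The index `μ(M) = [SL₂(ℤ) : Γ₀(M)] = #ℙ¹(ℤ/Mℤ) = M ∏_{ℓ ∣ M} (1 + 1/ℓ)` (Dedekind's `ψ`), written
as the finitely supported product `∏_{ℓ^e ∥ M} ℓ^{e-1} (ℓ + 1)` over `Nat.factorization M`
(value `1` at `M = 0`, junk). Fisher, arXiv:2106.02033, Lemma 2.2; Diamond–Shurman, *A First
Course in Modular Forms*, Ex. 1.2.3. [cite: Fisher2021SeventeenCongruent, Lemma 2.2 (the display defining μ(M))] -/
def gammaZeroIndex (M : ℕ) : ℕ :=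
  M.factorization.prod fun ℓ e => ℓ ^ (e - 1) * (ℓ + 1)

/-- `ℓ ∈ S`: at the prime `ℓ` one of `W`, `W'` has split multiplicative reduction and the other has
non-split multiplicative reduction (multiplicative, not split) — the set `S` of Kraus–Oesterlé's
Proposition 4 (Fisher, Lemma 2.2). A predicate on `ℓ : ℕ` (false at non-primes).
[cite: Fisher2021SeventeenCongruent, Lemma 2.2 (the set S)] -/
def MismatchedMultiplicativeAt (W W' : WeierstrassCurve ℚ) (ℓ : ℕ) : Prop :=
  ∃ _ : Fact ℓ.Prime,
    (W.HasSplitMultiplicativeReductionAtPrime ℓ ∧ W'.HasMultiplicativeReductionAtPrime ℓ ∧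
        ¬ W'.HasSplitMultiplicativeReductionAtPrime ℓ) ∨
      (W'.HasSplitMultiplicativeReductionAtPrime ℓ ∧ W.HasMultiplicativeReductionAtPrime ℓ ∧
        ¬ W.HasSplitMultiplicativeReductionAtPrime ℓ)

/-- The Kraus–Oesterlé modulus `M = lcm(N, N') · ∏_{ℓ ∈ S} ℓ` of Proposition 4 (Fisher, Lemma 2.2),
`N = W.conductorNorm ℤ`, `N' = W'.conductorNorm ℤ`, `S` as in `MismatchedMultiplicativeAt`; the
product is taken over the prime factors of `N · N'` satisfying `S` (a prime of multiplicative
reduction for both curves divides both conductors, so this is all of `S`).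
[cite: Fisher2021SeventeenCongruent, Lemma 2.2 (the modulus M)] -/
def modulus (W W' : WeierstrassCurve ℚ) [W.IsElliptic] [W'.IsElliptic] : ℕ :=
  Nat.lcm (W.conductorNorm ℤ) (W'.conductorNorm ℤ) *
    ∏ ℓ ∈ (W.conductorNorm ℤ * W'.conductorNorm ℤ).primeFactors.filter
      (MismatchedMultiplicativeAt W W'), ℓ

/-! ### The named fact -/

/-- **Kraus–Oesterlé 1992, Proposition 4, (ii) ⇒ (i), case `E[p]` irreducible.** A. Kraus,
J. Oesterlé, *Sur une question de B. Mazur*, Math. Ann. 293 (1992) 259–275, Prop. 4 — read in the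
restatement T. Fisher, arXiv:2106.02033, Lemma 2.2 "(KO)" (store chunk p0004 L18–L33, verbatim in the
module docstring; primary source not held, acq-05563, flag `KO92-secondary`): for (modular) elliptic
curves `E, E'/ℚ` of conductors `N, N'`, with `S`, `M = lcm(N,N') ∏_{ℓ∈S} ℓ` and
`μ(M) = [SL₂(ℤ) : Γ₀(M)]` as above, "`E[p]` and `E'[p]` have isomorphic semi-simplifications" iff
"`a_ℓ(E) ≡ a_ℓ(E') (mod p)` for all primes `ℓ < μ(M)/6` with `v_ℓ(NN') = 0`; and
`a_ℓ(E) a_ℓ(E') ≡ ℓ + 1 (mod p)` for all primes `ℓ < μ(M)/6` with `v_ℓ(NN') = 1`". Transcription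
(module docstring § faithfulness): `W, W'` globally minimal elliptic over `ℚ`, `p` prime, `E[p]`
IRREDUCIBLE (extra hypothesis, under which (i) is an isomorphism `E[p] ≅ E'[p]`); the congruences
(ii) for all primes `ℓ` with `6ℓ < μ(M)` (`gammaZeroIndex (modulus W W')`), `a_ℓ = frobeniusTrace`,
`v_ℓ(NN') = padicValNat ℓ (N·N')`; conclusion: a `Γ_ℚ`-equivariant additive isomorphism
`E[p] ≃ E'[p]`. Weaker than print (one direction, irreducible case) — ON UNEXPOSED PAIRS. SCOPE NOTE
(DD-81; flag `KO92-Prop4-(ii)b-frobeniusTrace-offset`, ARM-P REGISTER R-20; module docstring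
§ faithfulness): the tree's `frobeniusTrace W ℓ` is the Hasse–Weil `a_ℓ` at a prime of GOOD
reduction (`LFunction_apply_prime_eq_frobeniusTrace`) but `1 + a_ℓ ∈ {2, 0}` at a MULTIPLICATIVE
prime (`frobeniusTrace_eq_lFunction_add_one_of_mult`; the paper's `a_ℓ` there is `±1`, p. 262 Lemme 1,
p. 263 L8–9), so the `v_ℓ(NN') = 1` conjunct below is print's clause ONLY on pairs `(W, W')` with no
prime `ℓ`, `6ℓ < μ(M)`, `v_ℓ(NN') = 1` (PROVED equivalence of the two lists there:
`congruenceList_hasseWeil_iff_of_noExposedPrime`); on pairs with such a prime this hypothesis is NOT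
print's and the declaration is not a transcription of Prop. 4. Print-faithful twin (the `= 1 →`
conjunct over `WeierstrassCurve.LFunction ℓ`, Hasse–Weil at every prime; all else identical):
`prop4_torsionIso_of_congruences_hasseWeil` in `TorsionCongruenceCriterionHasseWeil.lean` — consumers
on exposed pairs re-key to it. The statement below is deliberately NOT edited (corrected under the
new name; its status as a closed `Prop` is ARM-P target T-Q41-2). [cite: KrausOesterle1992, Prop. 4 (read via Fisher arXiv:2106.02033 Lemma 2.2 "(KO)", store chunk p0004 L18–L33; primary not held, acq-05563)]
[cite: KrausOesterle1992, Prop. 4, pp. 263–264 (statement) and p. 262 §3 (setting: any prime p) — PRIMARY read 2026-08-19 on the open GDZ scan of Math. Ann. 293, quoted in the module docstring] -/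
def prop4_torsionIso_of_congruences : Prop :=
  ∀ (W W' : WeierstrassCurve ℚ) [W.IsElliptic] [W.IsGloballyMinimal] [W'.IsElliptic]
    [W'.IsGloballyMinimal] (p : ℕ) [Fact p.Prime],
    W.HasIrreducibleModPGaloisRep p →
    (∀ (ℓ : ℕ) [Fact ℓ.Prime], 6 * ℓ < gammaZeroIndex (modulus W W') →
      (padicValNat ℓ (W.conductorNorm ℤ * W'.conductorNorm ℤ) = 0 →
          (p : ℤ) ∣ W.frobeniusTrace ℓ - W'.frobeniusTrace ℓ) ∧
        (padicValNat ℓ (W.conductorNorm ℤ * W'.conductorNorm ℤ) = 1 →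
          (p : ℤ) ∣ W.frobeniusTrace ℓ * W'.frobeniusTrace ℓ - (ℓ + 1))) →
    ∃ e : geomTorsion W (p : ℤ) ≃+ geomTorsion W' (p : ℤ),
      ∀ (σ : Field.absoluteGaloisGroup ℚ) (P : geomTorsion W (p : ℤ)), e (σ • P) = σ • e P

/-! ### The certificate C1 of route U1′ in finite form -/

/-- **Certificate C1 of route U1′ (class X9, CM partner) as a finite list of congruences.** For a
globally minimal `W` with `E[p]` irreducible and a globally minimal `A` (the intended CM partner),
the Kraus–Oesterlé congruences below the bound `μ(M)/6` give the `Γ_ℚ`-equivariant isomorphism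
`A[p] ≃ E[p]` in the direction consumed by `Rank1Residual.X9.bsdp_of_cmPartner_of_certificates`
(hypothesis `hC1` there), by the named fact (`hKO`) and symmetry (the inverse of an equivariant
isomorphism is equivariant). The scope note of `prop4_torsionIso_of_congruences` applies verbatim to
`hcong` (flag `KO92-Prop4-(ii)b-frobeniusTrace-offset`): on a pair with an exposed prime use the
Hasse–Weil forwarder `torsionIso_of_congruences_hasseWeil` instead.
[cite: KrausOesterle1992, Prop. 4 (via Fisher arXiv:2106.02033 Lemma 2.2)] -/
theorem torsionIso_of_congruences (hKO : prop4_torsionIso_of_congruences)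
    (W A : WeierstrassCurve ℚ) [W.IsElliptic] [W.IsGloballyMinimal] [A.IsElliptic]
    [A.IsGloballyMinimal] (p : ℕ) [Fact p.Prime] (hirr : W.HasIrreducibleModPGaloisRep p)
    (hcong : ∀ (ℓ : ℕ) [Fact ℓ.Prime], 6 * ℓ < gammaZeroIndex (modulus W A) →
      (padicValNat ℓ (W.conductorNorm ℤ * A.conductorNorm ℤ) = 0 →
          (p : ℤ) ∣ W.frobeniusTrace ℓ - A.frobeniusTrace ℓ) ∧
        (padicValNat ℓ (W.conductorNorm ℤ * A.conductorNorm ℤ) = 1 →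
          (p : ℤ) ∣ W.frobeniusTrace ℓ * A.frobeniusTrace ℓ - (ℓ + 1))) :
    ∃ e : geomTorsion A (p : ℤ) ≃+ geomTorsion W (p : ℤ),
      ∀ (σ : Field.absoluteGaloisGroup ℚ) (P : geomTorsion A (p : ℤ)), e (σ • P) = σ • e P := by
  obtain ⟨e, he⟩ := hKO W A p hirr hcong
  refine ⟨e.symm, fun σ Q => e.injective ?_⟩
  rw [e.apply_symm_apply, he, e.apply_symm_apply]

end Literature.NumberTheory.EllipticCurves.KrausOesterle1992

end
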